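import Summits.HodgeConjecture.HodgeConjecture.Theorems.Ring2HypothesesAtlasSixfolds
import Summits.HodgeConjecture.HodgeConjecture.Theorems.Ring2HypothesesCMPowerClosure
import Literature.AlgebraicGeometry.HodgeTheory.HodgeGroupProductCMFactorClasses
import HarnessLib

/-!
# Ring 2 — hypotheses layer, part XIV-B: the generation predicate (G) at the anchors

HONEST FRAMING (page 1, verbatim): research route conditional on HC_CM; not a corollary;
Q11.4-sentence-2 already refuted in dim ≥ 3. `HC_CM` := `Theses.RankFourFaces.CMAbelianHodge`
(stmt-HodgeConjecture-3052), never used in this file.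

Part XIV (`Ring2HypothesesAtlasSixfolds`) serves atlas-2's Weil cells from `W₆` plus the TYPED generation
predicate `IsDivisorMultiWeilGenerated A` ("`B•(A) ⊆ D•(A) + Σ_k W_k`", the sum over ALL Weil structures of
`A`; a hypothesis on the member, never asserted). This file records, sorry-free and without any new fact,
WHERE in the kernel that predicate is already KNOWN to hold and where it DEGENERATES:

* (A1) `B = D` (`IsDivisorGenerated`, Literature) ⟹ (G): `isDivisorMultiWeilGenerated_of_isDivisorGenerated`.
* (A2) UNCONDITIONAL instances: every power `A^{M+1}` and every product `A × B` of varieties isogenous to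
  powers `E^{K+1}` of ONE CM elliptic curve has `B = D` (part XII, C3) hence (G) — these are exactly the
  CM-power ANCHORS `E_k^{6}` ∈ the closures of the three Weil families of atlas-2 (deform D.41 (1)(2)(5),
  the W1‴ anchor of part XIV `weilSixfolds_of_cmPowerPointed`): (G) is INHABITED at the anchors the
  hypotheses layer points its families at. `isDivisorGenerated_powSucc_of_isIsogenous_powSucc_of_cm`,
  `isDivisorMultiWeilGenerated_powSucc_of_isIsogenous_powSucc_of_cm`, `…_prod_…`.
* (A3) mod the NAMED fact Tankeev–Ribet (`TankeevRibet1983_hodgeClasses_divisorial_powers_simplePrimeDimension`,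
  a binder): every power of a simple abelian variety of prime dimension satisfies (G) —
  `isDivisorMultiWeilGenerated_powSucc_of_tankeevRibet` (the `Y₅^{N+1}`, `Y₇`, `Y₃^{N+1}` anchors).
* (A4) EXACTNESS IN ODD DIMENSION: a variety of odd dimension carries no Weil structure (`IsWeilType` forces
  `dim A = 2n`), so `allWeilClasses A p = ⊥` and (G) ⟺ `B = D` — `allWeilClasses_eq_bot_of_odd_dim`,
  `isDivisorMultiWeilGenerated_iff_isDivisorGenerated_of_odd_dim`. Consequence for the atlas: on the
  `g = 7` power cell `(E × Y₆)^{N+1}` at even `N` the predicate (G) only says `B = D`, which its members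
  violate in print (Moonen–Zarhin (3.8): `E × Y` carries Weil-TYPE Hodge classes in `H¹(E) ⊗ H^{2p-1}(Y)`);
  this is WHY part XIV serves the `g = 7` cell (and the K3-partner cell) through invariant cycles and not
  through (G) + (W). (G) sees only Weil structures on `A` itself, never those of factors or sub-products.

Nothing here is a new case of the Hodge conjecture: (A2)'s varieties already satisfy HC unconditionally
(part XII C4), (A3)'s mod Tankeev–Ribet (`hodgeConjectureFor_of_isDivisorGenerated`).

References: van Geemen, LNM 1594 (1994) §2.4–2.5 (`B`, `D`), Thm. 4.3 (Tate/Murasaki: `B(Eⁿ) = D(Eⁿ)`),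
Thm. 4.6 (Tankeev–Ribet), 4.9 (Weil type); Moonen–Zarhin, Math. Ann. 315 (1999) (2.7), (3.8).
-/

set_option linter.dupNamespace false

open CategoryTheory
open Literature.AlgebraicGeometry Literature.AlgebraicGeometry.Motives
open Literature.AlgebraicGeometry.HodgeTheory
open Literature.AlgebraicTopology.SingularHomology
open Literature.Barriers.HodgeConjecture (divisorClassesSpan)

namespace Summit.HodgeConjecture.HodgeConjecture.Ring2.Hypotheses

/-! ## §A1 `B = D` implies (G) -/

/-- **(A1)** A divisor-generated Hodge ring is divisor-plus-Weil generated (the Weil summand is not needed).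
[cite: vanGeemen1994HodgeAV, §2.4–2.5] -/
theorem isDivisorMultiWeilGenerated_of_isDivisorGenerated {A : AbelianVariety ℂ} (h : IsDivisorGenerated A) :
    IsDivisorMultiWeilGenerated A :=
  fun p c hc hpp ↦ Submodule.mem_sup_left (h p c hc hpp)

/-! ## §A2 The CM-power anchors: (G) holds UNCONDITIONALLY -/

section CMPower

variable {E : AbelianVariety ℂ} (hE : E.dim = 1) (φ : E ⟶ E) {d : ℕ} (hd : 0 < d) (hφ : φ ≫ φ = -(d • 𝟙 E))
include hE hd hφ

/-- **(A2) `B(A^{M+1}) = D(A^{M+1})` for `A ~ E^{K+1}`, `E` a CM elliptic curve** — part XII C3 read as the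
Literature predicate `IsDivisorGenerated`. UNCONDITIONAL. [cite: vanGeemen1994HodgeAV, Thm. 4.3 and §2.4–2.5] -/
theorem isDivisorGenerated_powSucc_of_isIsogenous_powSucc_of_cm (K : ℕ) {A : AbelianVariety ℂ}
    (hA : A.IsIsogenous (E.powSucc K)) (M : ℕ) : IsDivisorGenerated (A.powSucc M) :=
  fun p c hc hpp ↦
    EllipticCurve.hodgeClasses_divisorial_powSucc_of_isIsogenous_powSucc_of_cm hE φ hd hφ K hA M p c hc hpp

/-- **(A2′) `B(A × B) = D(A × B)` for `A ~ E^{a+1}`, `B ~ E^{b+1}`, `E` a CM elliptic curve.** UNCONDITIONAL.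
[cite: vanGeemen1994HodgeAV, Thm. 4.3 and §2.4–2.5] -/
theorem isDivisorGenerated_prod_of_isIsogenous_powSucc_of_cm {a b : ℕ} {A B : AbelianVariety ℂ}
    (hA : A.IsIsogenous (E.powSucc a)) (hB : B.IsIsogenous (E.powSucc b)) : IsDivisorGenerated (A.prod B) :=
  fun p c hc hpp ↦
    EllipticCurve.hodgeClasses_divisorial_prod_of_isIsogenous_powSucc_of_cm hE φ hd hφ hA hB p c hc hpp

/-- **(A2) ⟹ (G) on every power of a CM-elliptic power** — the generation hypothesis of part XIV's Weil rows
is INHABITED at the CM-power anchors `E_k^{6}` of the atlas-2 Weil families (deform D.41; part XIV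
`weilSixfolds_of_cmPowerPointed`). UNCONDITIONAL. [cite: vanGeemen1994HodgeAV, Thm. 4.3] -/
theorem isDivisorMultiWeilGenerated_powSucc_of_isIsogenous_powSucc_of_cm (K : ℕ) {A : AbelianVariety ℂ}
    (hA : A.IsIsogenous (E.powSucc K)) (M : ℕ) : IsDivisorMultiWeilGenerated (A.powSucc M) :=
  isDivisorMultiWeilGenerated_of_isDivisorGenerated
    (isDivisorGenerated_powSucc_of_isIsogenous_powSucc_of_cm hE φ hd hφ K hA M)

/-- **(A2′) ⟹ (G) on every product of two CM-elliptic powers of the same curve.** UNCONDITIONAL.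
[cite: vanGeemen1994HodgeAV, Thm. 4.3] -/
theorem isDivisorMultiWeilGenerated_prod_of_isIsogenous_powSucc_of_cm {a b : ℕ} {A B : AbelianVariety ℂ}
    (hA : A.IsIsogenous (E.powSucc a)) (hB : B.IsIsogenous (E.powSucc b)) :
    IsDivisorMultiWeilGenerated (A.prod B) :=
  isDivisorMultiWeilGenerated_of_isDivisorGenerated
    (isDivisorGenerated_prod_of_isIsogenous_powSucc_of_cm hE φ hd hφ hA hB)

end CMPower

/-! ## §A3 The Tankeev–Ribet anchors: (G) modulo the named fact -/

/-- **(A3)** Modulo Tankeev–Ribet (binder `h`, a theorem in print typed as a named Literature statement), every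
power `X^{N+1}` of a simple abelian variety of prime dimension satisfies (G) (indeed `B = D`).
[cite: MoonenZarhin1999LowDim, §2 Thm. (2.7)] [cite: vanGeemen1994HodgeAV, Thm. 4.6] -/
theorem isDivisorMultiWeilGenerated_powSucc_of_tankeevRibet
    (h : TankeevRibet1983_hodgeClasses_divisorial_powers_simplePrimeDimension)
    (X : AbelianVariety ℂ) {p : ℕ} (hp : p.Prime) (hX : X.dim = p) (hs : X.IsSimple) (N : ℕ) :
    IsDivisorMultiWeilGenerated (X.powSucc N) :=
  isDivisorMultiWeilGenerated_of_isDivisorGenerated (isDivisorGenerated_powSucc_of_tankeevRibet h X hp hX hs N)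

/-! ## §A4 Exactness in odd dimension: no Weil structure, (G) ⟺ `B = D` -/

/-- **(A4) A variety of odd dimension carries no Weil structure**, so the sum of its Weil planes is `0`.
[cite: vanGeemen1994HodgeAV, 4.9] -/
theorem allWeilClasses_eq_bot_of_odd_dim {A : AbelianVariety ℂ} (hA : Odd A.dim) (p : ℕ) :
    allWeilClasses A p = ⊥ := by
  rw [allWeilClasses, iSup_eq_bot]
  rintro ⟨w, hw⟩
  exact absurd (⟨p, by have := hw.dim_eq; omega⟩ : Even A.dim) (Nat.not_even_iff_odd.mpr hA)

/-- **(A4′) In odd dimension (G) is exactly `B = D`.** Hence on atlas-2's `g = 7` power cell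
`(E × Y₆)^{N+1}` at even `N` (odd total dimension `7(N+1)`) the hypothesis (G) of part XIV degenerates to
`B = D`, which those members violate in print (Moonen–Zarhin (3.8): Weil-type classes in
`H¹(E) ⊗ H^{2p-1}(Y)`) — the reason part XIV serves that cell through invariant cycles, not through (G) + (W).
[cite: vanGeemen1994HodgeAV, 4.9 and §2.4–2.5] [cite: MoonenZarhin1999LowDim, §3 (3.8)] -/
theorem isDivisorMultiWeilGenerated_iff_isDivisorGenerated_of_odd_dim {A : AbelianVariety ℂ} (hA : Odd A.dim) :
    IsDivisorMultiWeilGenerated A ↔ IsDivisorGenerated A := by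
  refine ⟨fun h p c hc hpp ↦ ?_, isDivisorMultiWeilGenerated_of_isDivisorGenerated⟩
  simpa [allWeilClasses_eq_bot_of_odd_dim hA p] using h p c hc hpp

/-- **(A4″) The same for products read in their own dimension**: if `dim A + dim B` is odd, (G) on `A × B`
is `B = D` on `A × B`. [cite: vanGeemen1994HodgeAV, 4.9] -/
theorem isDivisorMultiWeilGenerated_prod_iff_of_odd {A B : AbelianVariety ℂ} (h : Odd (A.dim + B.dim)) :
    IsDivisorMultiWeilGenerated (A.prod B) ↔ IsDivisorGenerated (A.prod B) :=
  isDivisorMultiWeilGenerated_iff_isDivisorGenerated_of_odd_dim (by rwa [AbelianVariety.dim_prod])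

end Summit.HodgeConjecture.HodgeConjecture.Ring2.Hypotheses
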